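import Summits.CriticalPhenomena.PercolationContinuityZ3.Theorems.SahiMasterFamilyL3Reduce

/-!
# Terminal triples: Lemma L3, part 2a — the case (β,γ): `esupp A ∩ esupp C` is mandatory for `C`

Part 2 of L3 (paper STRUCTURE-PROOF.md §11 case (β,γ) with §15, verified VERIFICATION-gen3.md): with an N0 coordinate
`e ∈ esupp A ∩ esupp B`, if `(A_e, B_e, C) ∈ Z_3` via `(A_e, C)` (so `A_e` ignores `esupp C`) and
`(A^e, B^e, C) ∈ Z_3` via `(B^e, C)` (so `B^e` ignores `esupp C`), then every coordinate of `esupp C` is mandatory for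
`C` (`pure_of_beta_gamma`): the configuration `esupp A ∩ esupp B ∖ {e}` lies in `B`, every `s ∈ esupp A ∩ esupp C`
is mandatory for `C` (else both `s`-minors are `(A,C)`-realised and Lemma (αα) applies), and then the `t`-minors,
`t ∈ esupp B ∩ esupp C`, force `t` mandatory for `C`.  Everything here is proved; axioms standard. [this work]
-/

noncomputable section

open scoped Classical

namespace Summit.CriticalPhenomena.PercolationContinuityZ3.Theorems

open Finset Function
open Literature.Probability.Percolation (DeterminedBy determinedBy_iff)
open Literature.Probability.LatticeModels.Kahn2022 (Affects)

variable {ι : Type*} [Fintype ι]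

/-! ### The case (β, γ): `C` is pure -/

/-- **Case (β,γ) of L3, first half.**  With an N0 coordinate `e ∈ esupp A ∩ esupp B`, if `(A_e, B_e, C) ∈ Z_3` via `(A_e, C)`
(so `A_e` ignores `esupp C`) and `(A^e, B^e, C) ∈ Z_3` via `(B^e, C)` (so `B^e` ignores `esupp C`), then every
coordinate of `esupp C` is mandatory for `C`. [this work] -/
theorem beta_gamma_partA {A B C : Set (Set ι)} (hA : IsUpperSet A) (hB : IsUpperSet B) (hC : IsUpperSet C)
    (hAB : (esupp A ∩ esupp B).Nonempty) (hAC : (esupp A ∩ esupp C).Nonempty)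
    (hprivA : esupp A ⊆ esupp B ∪ esupp C) (hprivB : esupp B ⊆ esupp A ∪ esupp C)
    (hprivC : esupp C ⊆ esupp A ∪ esupp B) (hcommon : ∀ i, i ∈ esupp A → i ∈ esupp B → i ∉ esupp C)
    (hNSA : ∀ s ∈ esupp A, ({s} : Set ι) ∉ A) (hNSB : ∀ s ∈ esupp B, ({s} : Set ι) ∉ B)
    (hmin : ∀ i ∈ esupp A ∪ esupp B ∪ esupp C, ∀ b : Bool, SuppZeroFlag 3 ![secAt i b A, secAt i b B, secAt i b C])
    {e : ι} (heA : e ∈ esupp A) (heB : e ∈ esupp B) (hA0 : Set.univ \ {e} ∈ A) (hB0 : Set.univ \ {e} ∈ B)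
    (hZA : ZVia (secAt e false A) C (secAt e false B)) (hZB : ZVia (secAt e true B) C (secAt e true A)) :
    (↑((esupp A ∩ esupp B).erase e) : Set ι) ∈ B ∧ ∀ s ∈ esupp A ∩ esupp C, secAt s false C = ∅ := by
  have heC : e ∉ esupp C := hcommon e heA heB
  set IAB := esupp A ∩ esupp B with hIAB
  set IAC := esupp A ∩ esupp C with hIAC
  set IBC := esupp B ∩ esupp C with hIBC
  have hA0u : IsUpperSet (secAt e false A) := isUpperSet_secAt e false hA
  have hA1u : IsUpperSet (secAt e true A) := isUpperSet_secAt e true hA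
  have hB0u : IsUpperSet (secAt e false B) := isUpperSet_secAt e false hB
  have hB1u : IsUpperSet (secAt e true B) := isUpperSet_secAt e true hB
  have hAne : A.Nonempty := ⟨_, hA0⟩
  have hBne : B.Nonempty := ⟨_, hB0⟩
  have hAnu : A ≠ Set.univ := (nonempty_of_esupp_nonempty ⟨e, heA⟩).2
  have hBnu : B ≠ Set.univ := (nonempty_of_esupp_nonempty ⟨e, heB⟩).2
  have hCne : C.Nonempty := by
    obtain ⟨i, hi⟩ := hAC; exact (nonempty_of_esupp_nonempty ⟨i, (mem_inter.1 hi).2⟩).1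
  have hCnu : C ≠ Set.univ := by
    obtain ⟨i, hi⟩ := hAC; exact (nonempty_of_esupp_nonempty ⟨i, (mem_inter.1 hi).2⟩).2
  obtain ⟨dA0C, pvA, -⟩ := zVia_pivotal hA0u hC hB0u hZA
  obtain ⟨dB1C, pvB, -⟩ := zVia_pivotal hB1u hC hA1u hZB
  have esA : esupp A = IAB ∪ IAC := by
    ext f; rw [mem_union, hIAB, hIAC, mem_inter, mem_inter]
    constructor
    · intro hf
      rcases mem_union.1 (hprivA hf) with h | h
      · exact Or.inl ⟨hf, h⟩
      · exact Or.inr ⟨hf, h⟩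
    · rintro (⟨h, -⟩ | ⟨h, -⟩) <;> exact h
  have esB : esupp B = IAB ∪ IBC := by
    ext f; rw [mem_union, hIAB, hIBC, mem_inter, mem_inter]
    constructor
    · intro hf
      rcases mem_union.1 (hprivB hf) with h | h
      · exact Or.inl ⟨h, hf⟩
      · exact Or.inr ⟨hf, h⟩
    · rintro (⟨-, h⟩ | ⟨h, -⟩) <;> exact h
  have esC : esupp C = IAC ∪ IBC := by
    ext f; rw [mem_union, hIAC, hIBC, mem_inter, mem_inter]
    constructor
    · intro hf
      rcases mem_union.1 (hprivC hf) with h | h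
      · exact Or.inl ⟨h, hf⟩
      · exact Or.inr ⟨h, hf⟩
    · rintro (⟨-, h⟩ | ⟨-, h⟩) <;> exact h
  have hIAC_B : ∀ s ∈ IAC, s ∉ esupp B := fun s hs h => hcommon s (mem_inter.1 hs).1 h (mem_inter.1 hs).2
  have hIBC_A : ∀ t ∈ IBC, t ∉ esupp A := fun t ht h => hcommon t h (mem_inter.1 ht).1 (mem_inter.1 ht).2
  have hIAB_C : ∀ f ∈ IAB, f ∉ esupp C := fun f hf => hcommon f (mem_inter.1 hf).1 (mem_inter.1 hf).2
  have esA0 : esupp (secAt e false A) ⊆ IAB := by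
    intro f hf
    have hf' := esupp_secAt_subset hA e false hf
    have hfA := (mem_erase.1 hf').2
    rw [esA, mem_union] at hfA
    rcases hfA with h | h
    · exact h
    · exact absurd (mem_inter.1 h).2 (Finset.disjoint_left.1 dA0C hf)
  -- `A`-membership of `e`-free configurations is `A_e`-membership, which only sees `esupp A_e ⊆ IAB`
  have memA_iff : ∀ η η' : Set ι, e ∉ η → e ∉ η' →
      η ∩ ↑(esupp (secAt e false A)) = η' ∩ ↑(esupp (secAt e false A)) → (η ∈ A ↔ η' ∈ A) := by
    intro η η' hη hη' heq
    rw [← mem_secAt_false_iff_of_notMem hη, ← mem_secAt_false_iff_of_notMem hη']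
    exact mem_iff_of_inter_esupp_eq hA0u heq
  -- Step 1: `(IAB ∖ e) ∈ B`
  have hIABmem : (↑(IAB.erase e) : Set ι) ∈ B := by
    set Rb : Set ι := ↑(IAB.erase e) ∪ ↑IAC with hRb
    have step : ∀ σ : Finset ι, σ ⊆ IBC → Rb ∪ ↑(IBC \ σ) ∈ B := by
      intro σ
      induction σ using Finset.induction_on with
      | empty =>
        intro _
        rw [Finset.sdiff_empty]
        refine (mem_iff_of_inter_esupp_eq hB (ω' := Set.univ \ {e}) ?_).2 hB0
        ext f
        simp only [hRb, Set.mem_inter_iff, Set.mem_union, mem_coe, mem_erase, Set.mem_sdiff, Set.mem_univ,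
          Set.mem_singleton_iff, true_and]
        constructor
        · rintro ⟨(⟨hfe, -⟩ | hfAC) | hfBC, hfB⟩
          · exact ⟨hfe, hfB⟩
          · exact absurd hfB (hIAC_B f hfAC)
          · exact ⟨fun hfe => heC (hfe ▸ (mem_inter.1 hfBC).2), hfB⟩
        · rintro ⟨hfe, hfB⟩
          refine ⟨?_, hfB⟩
          rw [esB, mem_union] at hfB
          rcases hfB with h | h
          · exact Or.inl (Or.inl ⟨hfe, h⟩)
          · exact Or.inr h
      | insert t σ htσ ih =>
        intro hsub
        have htBC : t ∈ IBC := hsub (mem_insert_self t σ)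
        have hσ : σ ⊆ IBC := fun i hi => hsub (mem_insert_of_mem hi)
        have hprev := ih hσ
        set Y : Set ι := Rb ∪ ↑(IBC \ insert t σ) with hYdef
        have heq : Rb ∪ ↑(IBC \ σ) = insert t Y := by
          ext i
          simp only [hYdef, Set.mem_union, mem_coe, mem_sdiff, Finset.mem_insert, Set.mem_insert_iff, not_or]
          constructor
          · rintro (hi | ⟨hiQ, hiσ⟩)
            · exact Or.inr (Or.inl hi)
            · by_cases hit : i = t
              · exact Or.inl hit
              · exact Or.inr (Or.inr ⟨hiQ, hit, hiσ⟩)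
          · rintro (rfl | hi | ⟨hiQ, -, hiσ⟩)
            · exact Or.inr ⟨htBC, htσ⟩
            · exact Or.inl hi
            · exact Or.inr ⟨hiQ, hiσ⟩
        rw [heq] at hprev
        by_contra hY
        have heY : e ∉ Y := by
          simp only [hYdef, hRb, Set.mem_union, mem_coe, mem_erase, mem_sdiff, not_or]
          exact ⟨⟨fun h => h.1 rfl, fun h => heC (mem_inter.1 h).2⟩, fun h => heC (mem_inter.1 h.1).2⟩
        -- `Y ∈ A_e`: its trace on `esupp A` is that of `univ ∖ {e}`
        have hYA0 : Y ∈ secAt e false A := by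
          rw [mem_secAt_false_iff_of_notMem heY]
          refine (mem_iff_of_inter_esupp_eq hA (ω' := Set.univ \ {e}) ?_).2 hA0
          ext f
          constructor
          · rintro ⟨hfY, hfA⟩
            exact ⟨⟨Set.mem_univ f, fun hfe => heY ((Set.mem_singleton_iff.1 hfe) ▸ hfY)⟩, hfA⟩
          · rintro ⟨⟨-, hfe⟩, hfA⟩
            rw [Set.mem_singleton_iff] at hfe
            refine ⟨?_, hfA⟩
            have hfA' : f ∈ esupp A := hfA
            rw [esA, mem_union] at hfA'
            rcases hfA' with h | h
            · exact Or.inl (Or.inl (mem_coe.2 (mem_erase.2 ⟨hfe, h⟩)))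
            · exact Or.inl (Or.inr (mem_coe.2 h))
        have hYB0 : Y ∉ secAt e false B := fun h => hY ((mem_secAt_false_iff_of_notMem heY).1 h)
        have hYB0' : insert t Y ∈ secAt e false B := by
          rw [mem_secAt_false_iff_of_notMem (show e ∉ insert t Y from ?_)]
          · exact hprev
          · rintro (h | h)
            · exact heC (h ▸ (mem_inter.1 htBC).2)
            · exact heY h
        exact pvA t (by rw [esC]; exact mem_union_right _ htBC) Y hYA0 hYB0 hYB0'
    have hRbB : Rb ∈ B := by
      have := step IBC subset_rfl
      rwa [Finset.sdiff_self, coe_empty, Set.union_empty] at this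
    -- strip `IAC`, which `B` ignores
    have hBI : Disjoint (esupp B) IAC := Finset.disjoint_left.2 fun f hfB hfAC => hIAC_B f hfAC hfB
    rw [mem_iff_sdiff_mem hB hBI] at hRbB
    have heq : Rb \ ↑IAC = ↑(IAB.erase e) := by
      ext i
      simp only [hRb, Set.mem_sdiff, Set.mem_union, mem_coe, mem_erase]
      constructor
      · rintro ⟨h | h, hni⟩
        · exact h
        · exact absurd h hni
      · intro h; exact ⟨Or.inl h, fun hiAC => hIAB_C i h.2 (mem_inter.1 hiAC).2⟩
    rwa [heq] at hRbB
  -- Step 2: every `s ∈ IAC` is not mandatory for `A`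
  have hAs0 : ∀ s ∈ IAC, Set.univ \ {s} ∈ A := by
    intro s hs
    have hsC := (mem_inter.1 hs).2
    have h1 : Set.univ \ {s} ∈ secAt e false A :=
      univ_diff_mem_of_not_affects hA0u ⟨Set.univ, by rw [mem_secAt]; simpa only [forceAt, cond_false] using hA0⟩
        (fun h' => Finset.disjoint_left.1 dA0C (mem_esupp.2 h') hsC)
    rw [mem_secAt] at h1; simp only [forceAt, cond_false] at h1
    exact hA Set.sdiff_subset h1
  -- the `A`-section `A_e` is nonconstant, with essential support inside `IAB ⊆ esupp B`
  have hA0ne' : ∃ u, u ∈ esupp (secAt e false A) := by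
    by_contra hno
    push Not at hno
    have hes : esupp (secAt e false A) = ∅ := Finset.eq_empty_iff_forall_notMem.2 hno
    rcases eq_empty_or_univ_of_esupp_eq_empty hA0u hes with h | h
    · have : Set.univ ∈ secAt e false A := by rw [mem_secAt]; simpa only [forceAt, cond_false] using hA0
      rw [h] at this; exact this
    · have : (∅ : Set ι) ∈ secAt e false A := by rw [h]; exact Set.mem_univ _
      rw [mem_secAt] at this; simp only [forceAt, cond_false, Set.empty_sdiff] at this
      exact hAnu (Set.eq_univ_of_forall fun η => hA (Set.empty_subset η) this)
  -- Step 3: every `s ∈ IAC` is mandatory for `C`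
  have mandAC : ∀ s ∈ IAC, secAt s false C = ∅ := by
    intro s hs
    have hsA := (mem_inter.1 hs).1
    have hsC := (mem_inter.1 hs).2
    have hse : s ≠ e := fun hse => heC (hse ▸ hsC)
    have hsB : s ∉ esupp B := hIAC_B s hs
    by_contra hCs
    have hCs' : Set.univ \ {s} ∈ C := by
      by_contra h; exact hCs ((secAt_false_eq_empty_iff hC s).2 h)
    -- both `s`-minors are realised by the `(A, C)`-section pairs
    have key : ∀ b : Bool, ZVia (secAt s b A) (secAt s b C) B := by
      intro b
      have hm := hmin s (by simp [hsA]) b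
      rw [secAt_eq_self_of_not_affects hB (fun h => hsB (mem_esupp.2 h)) b] at hm
      have hAs : IsUpperSet (secAt s b A) := isUpperSet_secAt s b hA
      have hCs : IsUpperSet (secAt s b C) := isUpperSet_secAt s b hC
      have hCsne : (secAt s b C).Nonempty := by
        refine ⟨Set.univ, ?_⟩
        cases b
        · rw [mem_secAt]; simpa only [forceAt, cond_false] using hCs'
        · exact univ_mem_secAt_true hC hCne s
      -- `∅ ∉ A_e`, the trace lemma for the `A`-sections at `s`
      have trace : ∀ (Z : Set ι), e ∉ Z →
          (Z ∪ ↑(IAC.erase s) ∈ secAt s b A ↔ Z ∈ secAt s b A) := by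
        intro Z heZ
        rw [mem_secAt, mem_secAt]
        have he1 : e ∉ forceAt s b (Z ∪ ↑(IAC.erase s)) := by
          cases b
          · simp only [forceAt, cond_false, Set.mem_sdiff, Set.mem_union, mem_coe, mem_erase, not_and]
            intro h
            rcases h with h | ⟨-, h⟩
            · exact absurd h heZ
            · exact absurd (mem_inter.1 h).2 heC
          · simp only [forceAt, cond_true, Set.mem_insert_iff, Set.mem_union, mem_coe, mem_erase, not_or]
            exact ⟨fun h => hse h.symm, heZ, fun h => heC (mem_inter.1 h.2).2⟩
        have he2 : e ∉ forceAt s b Z := by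
          cases b
          · simp only [forceAt, cond_false, Set.mem_sdiff]; exact fun h => heZ h.1
          · simp only [forceAt, cond_true, Set.mem_insert_iff, not_or]; exact ⟨fun h => hse h.symm, heZ⟩
        refine memA_iff _ _ he1 he2 ?_
        ext f
        simp only [Set.mem_inter_iff, mem_coe]
        constructor
        · rintro ⟨hf, hfA0⟩
          refine ⟨?_, hfA0⟩
          have hfAB : f ∈ IAB := esA0 hfA0
          have hfs : f ≠ s := fun hfs => hsB (hfs ▸ (mem_inter.1 hfAB).2)
          cases b
          · simp only [forceAt, cond_false, Set.mem_sdiff, Set.mem_union, mem_coe, mem_erase,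
              Set.mem_singleton_iff] at hf ⊢
            rcases hf with ⟨hf | ⟨-, hfAC⟩, hfs'⟩
            · exact ⟨hf, hfs'⟩
            · exact absurd (mem_inter.1 hfAB).2 (hIAC_B f hfAC)
          · simp only [forceAt, cond_true, Set.mem_insert_iff, Set.mem_union, mem_coe, mem_erase] at hf ⊢
            rcases hf with hf | hf | ⟨-, hfAC⟩
            · exact Or.inl hf
            · exact Or.inr hf
            · exact absurd (mem_inter.1 hfAB).2 (hIAC_B f hfAC)
        · rintro ⟨hf, hfA0⟩
          refine ⟨?_, hfA0⟩
          cases b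
          · simp only [forceAt, cond_false, Set.mem_sdiff, Set.mem_union] at hf ⊢
            exact ⟨Or.inl hf.1, hf.2⟩
          · simp only [forceAt, cond_true, Set.mem_insert_iff, Set.mem_union] at hf ⊢
            rcases hf with hf | hf
            · exact Or.inl hf
            · exact Or.inr (Or.inl hf)
      rcases (suppZeroFlag_three_iff_zVia _ _ _).1 hm with h | h | h
      · -- via (B, C-section), third the A-section
        exfalso
        obtain ⟨dBCs, -, q3⟩ := zVia_pivotal hB hCs hAs h
        have esCs : ∀ f ∈ esupp (secAt s b C), f ∈ IAC.erase s := by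
          intro f hf
          have hf' := esupp_secAt_subset hC s b hf
          rw [mem_erase] at hf' ⊢
          refine ⟨hf'.1, ?_⟩
          have hfC := hf'.2
          rw [esC, mem_union] at hfC
          rcases hfC with h' | h'
          · exact h'
          · exact absurd hf (fun hf => Finset.disjoint_left.1 dBCs (mem_inter.1 h').1 hf)
        have memCs : ∀ ζ : Set ι, (↑(IAC.erase s) : Set ι) ⊆ ζ → ζ ∈ secAt s b C :=
          fun ζ hζ => mem_of_esupp_subset hCs hCsne fun f hf => hζ (mem_coe.2 (esCs f hf))
        by_cases heAs : Affects (secAt s b A) e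
        · obtain ⟨Z, hZ, heZ'⟩ := heAs
          have heZ : e ∉ Z := fun h => hZ (by rwa [Set.insert_eq_of_mem h] at heZ')
          refine q3 e heB (Z ∪ ↑(IAC.erase s)) (memCs _ Set.subset_union_right) (fun h' => hZ ((trace Z heZ).1 h')) ?_
          rw [← Set.insert_union]
          exact hAs Set.subset_union_left heZ'
        · -- `A`-section at `s` ignores `e`
          have hsec : secAt e true (secAt s b A) = secAt e false (secAt s b A) := by
            rw [secAt_eq_self_of_not_affects hAs heAs true, secAt_eq_self_of_not_affects hAs heAs false]
          rw [secAt_comm (Ne.symm hse), secAt_comm (Ne.symm hse),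
            secAt_eq_self_of_not_affects hA0u (fun h' => Finset.disjoint_left.1 dA0C (mem_esupp.2 h') hsC) b]
            at hsec
          -- hsec : secAt s b (A^e) = A_e
          cases b
          · -- deletion: `A_s = A_e`, and the side condition at some `u ∈ esupp A_e ⊆ esupp B` fails
            obtain ⟨u, hu⟩ := hA0ne'
            have huB : u ∈ esupp B := (mem_inter.1 (esA0 hu)).2
            have hAsEq : secAt s false A = secAt e false A := by
              rw [← secAt_eq_self_of_not_affects hAs heAs false, secAt_comm (Ne.symm hse),
                secAt_eq_self_of_not_affects hA0u (fun h' => Finset.disjoint_left.1 dA0C (mem_esupp.2 h') hsC) false]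
            obtain ⟨Z, hZ, huZ⟩ := mem_esupp.1 hu
            have hI : Disjoint (esupp (secAt e false A)) (IAC.erase s) :=
              Finset.disjoint_left.2 fun f hf hfI =>
                hIAC_B f (mem_of_mem_erase hfI) (mem_inter.1 (esA0 hf)).2
            have hζ : Z ∪ ↑(IAC.erase s) ∉ secAt e false A := by
              intro h'
              apply hZ
              rw [mem_iff_sdiff_mem hA0u hI] at h'
              refine (mem_iff_of_inter_esupp_eq hA0u ?_).2 h'
              ext f
              simp only [Set.mem_inter_iff, Set.mem_sdiff, Set.mem_union, mem_coe]
              constructor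
              · rintro ⟨hf, hfA⟩
                exact ⟨⟨Or.inl hf, fun hfI => Finset.disjoint_left.1 hI hfA hfI⟩, hfA⟩
              · rintro ⟨⟨hf | hf, hfI⟩, hfA⟩
                · exact ⟨hf, hfA⟩
                · exact absurd hf hfI
            refine q3 u huB (Z ∪ ↑(IAC.erase s)) (memCs _ Set.subset_union_right) (by rw [hAsEq]; exact hζ) ?_
            rw [hAsEq, ← Set.insert_union]
            exact hA0u Set.subset_union_left huZ
          · -- contraction: `A^s`-world; then `A^e ⊆ (A^e)^s = A_e`, so `e` does not affect `A`
            have hsub : secAt e true A ⊆ secAt e false A := by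
              intro ω hω
              have := subset_secAt_true hA1u s hω
              rwa [hsec] at this
            have heq : secAt e true A = secAt e false A :=
              Set.Subset.antisymm hsub (secAt_false_subset_true hA e)
            exact not_affects_of_secAt_eq heq (mem_esupp.1 heA)
      · exact h
      · -- via (A-section, B): the `A`-section ignores `esupp B ∋ e`
        exfalso
        obtain ⟨dAsB, -, -⟩ := zVia_pivotal hAs hB hCs h
        have heAs : ¬ Affects (secAt s b A) e := fun h' => Finset.disjoint_left.1 dAsB (mem_esupp.2 h') heB
        have hsec : secAt e true (secAt s b A) = secAt e false (secAt s b A) := by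
          rw [secAt_eq_self_of_not_affects hAs heAs true, secAt_eq_self_of_not_affects hAs heAs false]
        rw [secAt_comm (Ne.symm hse), secAt_comm (Ne.symm hse),
          secAt_eq_self_of_not_affects hA0u (fun h' => Finset.disjoint_left.1 dA0C (mem_esupp.2 h') hsC) b] at hsec
        cases b
        · -- `A_s = A_e`: `esupp A_e ⊆ esupp B` nonempty contradicts `A_s ⟂ B`
          obtain ⟨u, hu⟩ := hA0ne'
          have huB : u ∈ esupp B := (mem_inter.1 (esA0 hu)).2
          have hAsEq : secAt s false A = secAt e false A := by
            rw [← secAt_eq_self_of_not_affects hAs heAs false, secAt_comm (Ne.symm hse),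
              secAt_eq_self_of_not_affects hA0u (fun h' => Finset.disjoint_left.1 dA0C (mem_esupp.2 h') hsC) false]
          rw [hAsEq] at dAsB
          exact Finset.disjoint_left.1 dAsB hu huB
        · have hsub : secAt e true A ⊆ secAt e false A := by
            intro ω hω
            have := subset_secAt_true hA1u s hω
            rwa [hsec] at this
          exact not_affects_of_secAt_eq (Set.Subset.antisymm hsub (secAt_false_subset_true hA e)) (mem_esupp.1 heA)
    -- Lemma (αα) for `(A, C, B)` at `s`
    have hmin' : ∀ f ∈ esupp A ∩ esupp B, SuppZeroFlag 3 ![secAt f true A, secAt f true C, secAt f true B] := by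
      intro f hf
      exact (suppZeroFlag_three_swap23 (isUpperSet_secAt f true hA) (isUpperSet_secAt f true hB)
        (isUpperSet_secAt f true hC)).1 (hmin f (by simp [(mem_inter.1 hf).1]) true)
    exact lemma_alpha_alpha hA hC hB hAB (by rwa [union_comm] at hprivA) hprivC hprivB
      (fun i hiA hiC hiB => hcommon i hiA hiB hiC) hNSA hNSB hsA hsC (hAs0 s hs) hCs' (key false) (key true) hmin'
  exact ⟨hIABmem, mandAC⟩

end Summit.CriticalPhenomena.PercolationContinuityZ3.Theorems
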